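import Mathlib
import HarnessLib
import Summits.CriticalPhenomena.PercolationContinuityZ3.Theses.PercBoundarySqueeze
import Summits.CriticalPhenomena.PercolationContinuityZ3.Theorems.QuantitativeBGN.Negative.LoadBearing
import Summits.CriticalPhenomena.PercolationContinuityZ3.Theorems.PercBoundarySqueezeHalfSpaceOneArmRateStubShellSubmult

/-!
# Crux `PercBoundarySqueeze.HalfSpaceOneArmRate` (stmt-CriticalPhenomena-6983) — reduction to a half-space shell-crossing bound

Helper file landed `--supports stmt-CriticalPhenomena-6983` by the line lead (line `registered`, skeleton
`Cruxes/HalfSpaceOneArmRate/Lines/birth.lean`). The crux is the RATE statement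

  `HalfSpaceOneArmRate : ∃ b > 1/2, C, ∀ r ≥ 1, P_{p_c(ℤ³)}(arm_H(0,r)) ≤ C r^{-b}`,

`arm_H(0,r) = armH r` = the open cluster of `0` in `H = {x₀ ≥ 0}` reaches sup-distance `≥ r`
(`Theorems/QuantitativeBGN/Negative/ArmLowerBound.lean`). The line splits it into the p-blind
submultiplicativity `stub_shellSubmult` (LANDED: `Theorems/PercBoundarySqueezeHalfSpaceOneArmRateStubShellSubmult.lean`,
`P_p(arm_H(0,R)) ≤ P_p(arm_H(0,r)) · P_p(ShellCross_H(r,R))`, where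
`ShellCross_H(r,R) = {∃ w y, ‖w‖∞ ≤ r+1, ‖y‖∞ ≥ R, w ↔ y open inside H ∩ {‖x‖∞ > r}}`) and the OPEN
stub `stub_shellDecay` (`∃ m ≥ 2, r₀ ≥ 1, b > 1/2, ∀ r ≥ r₀, P_{p_c}(ShellCross_H(r, m r)) ≤ m^{-b}`).
With the submultiplicativity proved, this file records, sorry-free and over tree vocabulary only:

* `rate_of_shell_product_bound` — the multiscale bookkeeping in PRODUCT form: if `P ≤ 1` is antitone and
  `P R ≤ P r · Q r R` (`1 ≤ r < R`, `Q ≥ 0`), and `∏_{j<k} Q (m^j r₀) (m^{j+1} r₀) ≤ C₀ (m^{-b})^k` for all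
  `k`, then `P r ≤ max C₀ 1 · (m r₀)^b · r^{-b}` for `r ≥ 1` (window `m^k r₀ ≤ r < m^{k+1} r₀` via `Nat.log`;
  the per-scale version of the registered skeleton is the case `C₀ = 1`, `prod_le_pow_of_forall_le`);
* `armH_rate_of_shellProductWith`, `armH_rate_of_shellDecayWith` — the arm rate at `p_c(ℤ³)` with
  exponent `b` from a product, resp. per-scale, shell-crossing bound with exponent `b`, for EVERY `b > 0`;
* **cone edges** `halfSpaceOneArmRate_of_shellDecay` (the registered stub `stub_shellDecay` ⇒ the crux BY
  NAME — so the open stub is at least crux-strength) and `halfSpaceOneArmRate_of_shellProduct` (the weaker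
  product / geometric-mean form ⇒ the crux: single bad scales are tolerated; this is the weakest input of
  shell-crossing type the line's bookkeeping accepts);
* **tightness** `not_shellDecayWith_of_two_lt`, `not_exists_shellDecay_two_lt` — the per-scale stub with
  exponent `b > 2` is FALSE (it would give `P_{p_c}(arm_H(0,r)) ≤ C r^{-b}`, against the disprover's
  floor `P_{p_c}(arm_H(0,n+1)) ≥ 1/(588 (n+1)²)`, `not_quantitativeBGNWith_of_two_lt`), so the open stub
  lives in the window `1/2 < b ≤ 2` (numerically `b` up to `x_s ≈ 0.975`, Deng–Blöte 2005).

Relation to the sibling crux `PercLowPointHalfSpace.QuantitativeBGN` (stmt-0913, `∃ a > 0`, same event):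
its lead c6 landed the dyadic analogue `quantitativeBGN_of_halfAnnulusCrossingBound` /
`…_of_halfSpaceCesaroBlocking` (`Theorems/PercLowPointHalfSpaceQuantitativeBGNHalfSpaceBlocking.lean`):
ANY uniform half-annulus blocking `η > 0` gives SOME rate `a > 0`. The present crux needs the blocking
QUANTIFIED — at ratio `m`, crossing probability `≤ m^{-b}` with `b > 1/2` (at `m = 2`: blocking
`≥ 1 − 2^{-1/2} ≈ 0.293` per dyadic scale, at least in geometric mean) — which is the honest open content
of `b > 1/2` (a scale-uniform crossing upper bound of RSW / quasi-multiplicativity class in `d = 3`; none is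
known; BGN's `θ_H(p_c) = 0` gives `P(ShellCross_H(r,R)) → 0` in `R` for fixed `r` only).

No definitions, no sorry. Sources: Grimmett, *Percolation* (1999), §1.4, §2.2, Thm. (7.35)
[GrimmettPercolation1999]; Kesten's multiscale product argument, Grimmett 1999 §11.7.
-/

noncomputable section

namespace Summit.CriticalPhenomena.PercolationContinuityZ3.Theorems

namespace HalfSpaceOneArmRateOfShellDecay

open MeasureTheory
open Literature.Probability.Percolation Literature.Probability.LatticeModels
open Summit.CriticalPhenomena.PercolationContinuityZ3.Theses.PercBoundarySqueeze (HalfSpaceOneArmRate)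
open Summit.CriticalPhenomena.PercolationContinuityZ3.Theorems.QuantitativeBGN.Negative
  (armH armH_antitone QuantitativeBGNWith not_quantitativeBGNWith_of_two_lt)

/-! ## Readback -/

/-- READBACK: the crux `HalfSpaceOneArmRate` is literally the rate statement for the event `armH r`
(`Theorems/QuantitativeBGN/Negative/ArmLowerBound.lean`) under `P_{p_c(ℤ³)}`. [folklore] -/
theorem halfSpaceOneArmRate_iff :
    HalfSpaceOneArmRate ↔ ∃ b C : ℝ, 1 / 2 < b ∧ ∀ r : ℕ, 1 ≤ r →
      (bondPercolation (zdGraph 3) (criticalProbI 3)).real (armH r) ≤ C * (r : ℝ) ^ (-b) :=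
  Iff.rfl

/-! ## Multiscale bookkeeping: a product bound over the scales `m^j r₀` gives a polynomial rate -/

/-- **Geometric-to-polynomial bookkeeping, product form.** Let `P : ℕ → (-∞,1]` be non-increasing
and submultiplicative across shells, `P R ≤ P r · Q r R` for `1 ≤ r < R` with factors `Q ≥ 0`. If the
PRODUCT of the factors along the scales `r₀, m r₀, …, m^k r₀` is at most `C₀ · m^{-bk}` for every `k`
(`m ≥ 2`, `r₀ ≥ 1`, `b > 0`), then `P r ≤ max C₀ 1 · (m r₀)^b · r^{-b}` for every `r ≥ 1`.
(The per-scale form `Q (m^j r₀) (m^{j+1} r₀) ≤ m^{-b}` is the case `C₀ = 1`; this form also tolerates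
finitely many, or sparsely many, bad scales.) [folklore] -/
theorem rate_of_shell_product_bound (P : ℕ → ℝ) (Q : ℕ → ℕ → ℝ)
    (hP1 : ∀ r, P r ≤ 1) (hanti : Antitone P) (hQ0 : ∀ r R, 0 ≤ Q r R)
    (hsub : ∀ r R : ℕ, 1 ≤ r → r < R → P R ≤ P r * Q r R)
    {m r₀ : ℕ} {b C₀ : ℝ} (hm : 2 ≤ m) (hr₀ : 1 ≤ r₀) (hb : 0 < b)
    (hQ : ∀ k : ℕ, ∏ j ∈ Finset.range k, Q (m ^ j * r₀) (m ^ (j + 1) * r₀) ≤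
      C₀ * ((m : ℝ) ^ (-b)) ^ k) :
    ∀ r : ℕ, 1 ≤ r → P r ≤ max C₀ 1 * ((m : ℝ) * r₀) ^ b * (r : ℝ) ^ (-b) := by
  have hm1 : 1 < m := lt_of_lt_of_le one_lt_two hm
  have hmR : (0 : ℝ) < m := by exact_mod_cast (lt_trans zero_lt_one hm1)
  have hr₀R : (0 : ℝ) < r₀ := by exact_mod_cast hr₀
  have hq0 : (0 : ℝ) ≤ (m : ℝ) ^ (-b) := Real.rpow_nonneg hmR.le _
  set C₁ : ℝ := max C₀ 1 with hC₁
  have hC₁1 : (1 : ℝ) ≤ C₁ := le_max_right _ _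
  have hC₁0 : (0 : ℝ) ≤ C₁ := zero_le_one.trans hC₁1
  -- Step 1a: `P (m^k r₀) ≤ P r₀ · ∏_{j<k} Q (m^j r₀) (m^{j+1} r₀)` by induction (submultiplicativity).
  have hprod : ∀ k : ℕ, P (m ^ k * r₀) ≤
      P r₀ * ∏ j ∈ Finset.range k, Q (m ^ j * r₀) (m ^ (j + 1) * r₀) := by
    intro k
    induction k with
    | zero => simp
    | succ k ih =>
      have hmk : 1 ≤ m ^ k := Nat.one_le_pow _ _ (lt_trans zero_lt_one hm1)
      have hr : 1 ≤ m ^ k * r₀ := le_trans hr₀ (Nat.le_mul_of_pos_left r₀ hmk)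
      have hrR : m ^ k * r₀ < m ^ (k + 1) * r₀ :=
        Nat.mul_lt_mul_of_pos_right (Nat.pow_lt_pow_right hm1 (Nat.lt_succ_self k)) hr₀
      have h1 := hsub _ _ hr hrR
      calc P (m ^ (k + 1) * r₀) ≤ P (m ^ k * r₀) * Q (m ^ k * r₀) (m ^ (k + 1) * r₀) := h1
        _ ≤ (P r₀ * ∏ j ∈ Finset.range k, Q (m ^ j * r₀) (m ^ (j + 1) * r₀)) *
              Q (m ^ k * r₀) (m ^ (k + 1) * r₀) :=
            mul_le_mul_of_nonneg_right ih (hQ0 _ _)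
        _ = P r₀ * ∏ j ∈ Finset.range (k + 1), Q (m ^ j * r₀) (m ^ (j + 1) * r₀) := by
            rw [Finset.prod_range_succ, mul_assoc]
  -- Step 1b: geometric decay along the scales `m^k r₀`, with the constant `C₁ = max C₀ 1`.
  have hgeo : ∀ k : ℕ, P (m ^ k * r₀) ≤ C₁ * ((m : ℝ) ^ (-b)) ^ k := by
    intro k
    have hPi0 : 0 ≤ ∏ j ∈ Finset.range k, Q (m ^ j * r₀) (m ^ (j + 1) * r₀) :=
      Finset.prod_nonneg fun j _ => hQ0 _ _
    calc P (m ^ k * r₀) ≤ P r₀ * ∏ j ∈ Finset.range k, Q (m ^ j * r₀) (m ^ (j + 1) * r₀) := hprod k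
      _ ≤ 1 * ∏ j ∈ Finset.range k, Q (m ^ j * r₀) (m ^ (j + 1) * r₀) :=
          mul_le_mul_of_nonneg_right (hP1 r₀) hPi0
      _ ≤ C₀ * ((m : ℝ) ^ (-b)) ^ k := by rw [one_mul]; exact hQ k
      _ ≤ C₁ * ((m : ℝ) ^ (-b)) ^ k := mul_le_mul_of_nonneg_right (le_max_left _ _) (pow_nonneg hq0 k)
  -- Step 2: every `r ≥ 1` sits in a window `m^k r₀ ≤ r < m^(k+1) r₀` (or below `r₀`, with `k = 0`).
  have hwin : ∀ r : ℕ, 1 ≤ r → ∃ k : ℕ, P r ≤ C₁ * ((m : ℝ) ^ (-b)) ^ k ∧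
      (r : ℝ) ≤ (m : ℝ) ^ k * ((m : ℝ) * r₀) := by
    intro r hr
    by_cases hlt : r < r₀
    · refine ⟨0, ?_, ?_⟩
      · simpa using (hP1 r).trans hC₁1
      · have h1 : (r : ℝ) ≤ r₀ := by exact_mod_cast hlt.le
        have h2 : (r₀ : ℝ) ≤ (m : ℝ) * r₀ := le_mul_of_one_le_left hr₀R.le (by exact_mod_cast hm1.le)
        simpa using h1.trans h2
    · rw [not_lt] at hlt
      set n := r / r₀ with hn
      have hn0 : n ≠ 0 := by
        rw [hn]
        exact (Nat.div_pos hlt (lt_of_lt_of_le zero_lt_one hr₀)).ne'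
      set k := Nat.log m n with hk
      refine ⟨k, ?_, ?_⟩
      · have hle : m ^ k * r₀ ≤ r := by
          calc m ^ k * r₀ ≤ n * r₀ := Nat.mul_le_mul_right r₀ (Nat.pow_log_le_self m hn0)
            _ ≤ r := Nat.div_mul_le_self r r₀
        exact (hanti hle).trans (hgeo k)
      · have hlt' : r < m ^ (k + 1) * r₀ := by
          have h1 : r < n * r₀ + r₀ := Nat.lt_div_mul_add (lt_of_lt_of_le zero_lt_one hr₀)
          have h2 : n + 1 ≤ m ^ (k + 1) := Nat.lt_pow_succ_log_self hm1 n
          calc r < (n + 1) * r₀ := by simpa [add_mul] using h1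
            _ ≤ m ^ (k + 1) * r₀ := Nat.mul_le_mul_right r₀ h2
        have h3 : (r : ℝ) ≤ ((m ^ (k + 1) * r₀ : ℕ) : ℝ) := by exact_mod_cast hlt'.le
        have e : ((m ^ (k + 1) * r₀ : ℕ) : ℝ) = (m : ℝ) ^ k * ((m : ℝ) * r₀) := by push_cast; ring
        rw [e] at h3
        exact h3
  -- Step 3: convert `C₁ (m^{-b})^k` into `C₁ (m r₀)^b · r^{-b}` on the window.
  intro r hr
  obtain ⟨k, hPk, hrk⟩ := hwin r hr
  have hrR : (0 : ℝ) < r := by exact_mod_cast hr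
  have hmk : (0 : ℝ) < (m : ℝ) ^ k := pow_pos hmR k
  have hmr₀ : (0 : ℝ) < (m : ℝ) * r₀ := mul_pos hmR hr₀R
  have e1 : ((m : ℝ) ^ (-b)) ^ k = ((m : ℝ) ^ k) ^ (-b) := by
    rw [← Real.rpow_natCast, ← Real.rpow_mul hmR.le, mul_comm, Real.rpow_mul hmR.le, Real.rpow_natCast]
  have e2 : ((m : ℝ) ^ k * ((m : ℝ) * r₀)) ^ (-b) ≤ (r : ℝ) ^ (-b) :=
    Real.rpow_le_rpow_of_nonpos hrR hrk (by linarith)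
  have e3 : ((m : ℝ) ^ k) ^ (-b) = ((m : ℝ) ^ k * ((m : ℝ) * r₀)) ^ (-b) * ((m : ℝ) * r₀) ^ b := by
    rw [Real.mul_rpow hmk.le hmr₀.le, mul_assoc, Real.rpow_neg hmr₀.le,
      inv_mul_cancel₀ (Real.rpow_pos_of_pos hmr₀ b).ne', mul_one]
  calc P r ≤ C₁ * ((m : ℝ) ^ (-b)) ^ k := hPk
    _ = C₁ * (((m : ℝ) ^ k * ((m : ℝ) * r₀)) ^ (-b) * ((m : ℝ) * r₀) ^ b) := by rw [e1, e3]
    _ ≤ C₁ * ((r : ℝ) ^ (-b) * ((m : ℝ) * r₀) ^ b) :=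
      mul_le_mul_of_nonneg_left (mul_le_mul_of_nonneg_right e2 (Real.rpow_nonneg hmr₀.le b)) hC₁0
    _ = C₁ * ((m : ℝ) * r₀) ^ b * (r : ℝ) ^ (-b) := by ring

/-- The per-scale form implies the product form with `C₀ = 1`: if `Q (m^j r₀) (m^{j+1} r₀) ≤ m^{-b}`
for every `j` (e.g. because `Q r (m r) ≤ m^{-b}` for all `r ≥ r₀`) and `Q ≥ 0`, then
`∏_{j<k} Q (m^j r₀) (m^{j+1} r₀) ≤ (m^{-b})^k`. [folklore] -/
theorem prod_le_pow_of_forall_le (Q : ℕ → ℕ → ℝ) (hQ0 : ∀ r R, 0 ≤ Q r R) {m r₀ : ℕ} {q : ℝ}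
    (hQ : ∀ j : ℕ, Q (m ^ j * r₀) (m ^ (j + 1) * r₀) ≤ q) (k : ℕ) :
    ∏ j ∈ Finset.range k, Q (m ^ j * r₀) (m ^ (j + 1) * r₀) ≤ q ^ k := by
  rw [← Finset.card_range k, ← Finset.prod_const, Finset.card_range]
  exact Finset.prod_le_prod (fun j _ => hQ0 _ _) fun j _ => hQ j

/-! ## The half-space arm rate from a shell-crossing bound (every exponent `b > 0`; product form first) -/

/-- **Arm rate from a PRODUCT shell-crossing bound (any `b > 0`).** If at `p_c(ℤ³)` the product over
`j < k` of the shell-crossing probabilities `P(ShellCross_H(m^j r₀, m^{j+1} r₀))` is at most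
`C₀ · m^{-bk}` for every `k` (`m ≥ 2`, `r₀ ≥ 1`, `b > 0`), then
`P_{p_c}(arm_H(0,r)) ≤ max C₀ 1 · (m r₀)^b · r^{-b}` for every `r ≥ 1`. [folklore] -/
theorem armH_rate_of_shellProductWith {m r₀ : ℕ} {b C₀ : ℝ} (hm : 2 ≤ m) (hr₀ : 1 ≤ r₀) (hb : 0 < b)
    (hQ : ∀ k : ℕ, ∏ j ∈ Finset.range k,
      (bondPercolation (zdGraph 3) (criticalProbI 3)).real
        {ω | ∃ w y : Site 3, (∀ i : Fin 3, |w i| ≤ ((m ^ j * r₀ : ℕ) : ℤ) + 1) ∧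
          (∃ i : Fin 3, ((m ^ (j + 1) * r₀ : ℕ) : ℤ) ≤ |y i|) ∧
          ω ∈ openConnIn {x : Site 3 | 0 ≤ x 0 ∧ ∃ i : Fin 3, ((m ^ j * r₀ : ℕ) : ℤ) < |x i|} w y} ≤
      C₀ * (m : ℝ) ^ (-b * k)) :
    ∀ r : ℕ, 1 ≤ r →
      (bondPercolation (zdGraph 3) (criticalProbI 3)).real (armH r) ≤
        max C₀ 1 * ((m : ℝ) * r₀) ^ b * (r : ℝ) ^ (-b) := by
  have hm1 : 1 < m := lt_of_lt_of_le one_lt_two hm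
  have hmR : (0 : ℝ) < m := by exact_mod_cast (lt_trans zero_lt_one hm1)
  refine rate_of_shell_product_bound
    (fun r => (bondPercolation (zdGraph 3) (criticalProbI 3)).real (armH r))
    (fun r R => (bondPercolation (zdGraph 3) (criticalProbI 3)).real
      {ω | ∃ w y : Site 3, (∀ i : Fin 3, |w i| ≤ (r : ℤ) + 1) ∧ (∃ i : Fin 3, (R : ℤ) ≤ |y i|) ∧
        ω ∈ openConnIn {x : Site 3 | 0 ≤ x 0 ∧ ∃ i : Fin 3, (r : ℤ) < |x i|} w y})
    (fun r => measureReal_le_one)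
    (fun r s hrs => measureReal_mono (armH_antitone hrs)) (fun r R => measureReal_nonneg)
    (fun r R hr hrR => stub_shellSubmult (criticalProbI 3) r R hr hrR) hm hr₀ hb fun k => ?_
  have e : ((m : ℝ) ^ (-b)) ^ k = (m : ℝ) ^ (-b * k) := by
    rw [← Real.rpow_natCast, ← Real.rpow_mul hmR.le]
  rw [e]
  exact hQ k

/-- **Arm rate from a per-scale shell-crossing bound (any `b > 0`).** If at `p_c(ℤ³)` the half-space
shell crossing `ShellCross_H(r, m r) = {∃ w y, ‖w‖∞ ≤ r+1, ‖y‖∞ ≥ m r, w ↔ y open inside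
H ∩ {‖x‖∞ > r}}` has probability `≤ m^{-b}` for every `r ≥ r₀` (`m ≥ 2`, `r₀ ≥ 1`, `b > 0`), then
`P_{p_c}(arm_H(0,r)) ≤ (m r₀)^b r^{-b}` for every `r ≥ 1`. Ingredients: the landed stub
`stub_shellSubmult` (submultiplicativity across a shell, p-blind), `armH_antitone`, `0 ≤ P ≤ 1`, and
`rate_of_shell_product_bound` (via `armH_rate_of_shellProductWith` with `C₀ = 1`). [folklore] -/
theorem armH_rate_of_shellDecayWith {m r₀ : ℕ} {b : ℝ} (hm : 2 ≤ m) (hr₀ : 1 ≤ r₀) (hb : 0 < b)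
    (hQ : ∀ r : ℕ, r₀ ≤ r →
      (bondPercolation (zdGraph 3) (criticalProbI 3)).real
        {ω | ∃ w y : Site 3, (∀ i : Fin 3, |w i| ≤ (r : ℤ) + 1) ∧ (∃ i : Fin 3, ((m * r : ℕ) : ℤ) ≤ |y i|) ∧
          ω ∈ openConnIn {x : Site 3 | 0 ≤ x 0 ∧ ∃ i : Fin 3, (r : ℤ) < |x i|} w y} ≤ (m : ℝ) ^ (-b)) :
    ∀ r : ℕ, 1 ≤ r →
      (bondPercolation (zdGraph 3) (criticalProbI 3)).real (armH r) ≤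
        ((m : ℝ) * r₀) ^ b * (r : ℝ) ^ (-b) := by
  have hm1 : 1 < m := lt_of_lt_of_le one_lt_two hm
  have hmR : (0 : ℝ) < m := by exact_mod_cast (lt_trans zero_lt_one hm1)
  have key := armH_rate_of_shellProductWith (C₀ := 1) hm hr₀ hb (fun k => ?_)
  · intro r hr
    have h := key r hr
    rwa [max_self, one_mul] at h
  · have e : (m : ℝ) ^ (-b * k) = ((m : ℝ) ^ (-b)) ^ k := by
      rw [← Real.rpow_natCast, ← Real.rpow_mul hmR.le]
    rw [one_mul, e]
    refine prod_le_pow_of_forall_le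
      (fun r R => (bondPercolation (zdGraph 3) (criticalProbI 3)).real
        {ω | ∃ w y : Site 3, (∀ i : Fin 3, |w i| ≤ (r : ℤ) + 1) ∧ (∃ i : Fin 3, (R : ℤ) ≤ |y i|) ∧
          ω ∈ openConnIn {x : Site 3 | 0 ≤ x 0 ∧ ∃ i : Fin 3, (r : ℤ) < |x i|} w y})
      (fun r R => measureReal_nonneg) (fun j => ?_) k
    have hmj : 1 ≤ m ^ j := Nat.one_le_pow _ _ (lt_trans zero_lt_one hm1)
    have h := hQ (m ^ j * r₀) (Nat.le_mul_of_pos_left r₀ hmj)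
    have e' : m * (m ^ j * r₀) = m ^ (j + 1) * r₀ := by ring
    rw [e'] at h
    exact h

/-! ## Cone edges: the registered stub, and its product weakening, each prove the crux BY NAME -/

/-- **Cone edge (registered stub ⇒ crux).** The registered stub `stub_shellDecay` of line `registered`
— `∃ m ≥ 2, r₀ ≥ 1, b > 1/2, ∀ r ≥ r₀, P_{p_c}(ShellCross_H(r, m r)) ≤ m^{-b}` — implies
`HalfSpaceOneArmRate` (with the same `b` and `C = (m r₀)^b`). Since `stub_shellSubmult` is proved, the
open stub is therefore AT LEAST crux-strength. [folklore] -/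
theorem halfSpaceOneArmRate_of_shellDecay :
    (∃ (m r₀ : ℕ) (b : ℝ), 2 ≤ m ∧ 1 ≤ r₀ ∧ 1 / 2 < b ∧ ∀ r : ℕ, r₀ ≤ r →
      (bondPercolation (zdGraph 3) (criticalProbI 3)).real
        {ω | ∃ w y : Site 3, (∀ i : Fin 3, |w i| ≤ (r : ℤ) + 1) ∧ (∃ i : Fin 3, ((m * r : ℕ) : ℤ) ≤ |y i|) ∧
          ω ∈ openConnIn {x : Site 3 | 0 ≤ x 0 ∧ ∃ i : Fin 3, (r : ℤ) < |x i|} w y} ≤ (m : ℝ) ^ (-b)) →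
    Summit.CriticalPhenomena.PercolationContinuityZ3.Theses.PercBoundarySqueeze.HalfSpaceOneArmRate := by
  rintro ⟨m, r₀, b, hm, hr₀, hb, hQ⟩
  exact ⟨b, ((m : ℝ) * r₀) ^ b, hb, armH_rate_of_shellDecayWith hm hr₀ (by linarith) hQ⟩

/-- **Cone edge (product form ⇒ crux).** The WEAKER product/Cesàro form — `∃ m ≥ 2, r₀ ≥ 1, b > 1/2,
C₀, ∀ k, ∏_{j<k} P_{p_c}(ShellCross_H(m^j r₀, m^{j+1} r₀)) ≤ C₀ m^{-bk}` (the geometric mean of the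
shell-crossing probabilities along the scales `m^j r₀` eventually beats `m^{-1/2}`; single bad scales
are tolerated) — also implies `HalfSpaceOneArmRate`. This is the weakest input of shell-crossing type
that the line's bookkeeping accepts. [folklore] -/
theorem halfSpaceOneArmRate_of_shellProduct :
    (∃ (m r₀ : ℕ) (b C₀ : ℝ), 2 ≤ m ∧ 1 ≤ r₀ ∧ 1 / 2 < b ∧ ∀ k : ℕ, ∏ j ∈ Finset.range k,
      (bondPercolation (zdGraph 3) (criticalProbI 3)).real
        {ω | ∃ w y : Site 3, (∀ i : Fin 3, |w i| ≤ ((m ^ j * r₀ : ℕ) : ℤ) + 1) ∧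
          (∃ i : Fin 3, ((m ^ (j + 1) * r₀ : ℕ) : ℤ) ≤ |y i|) ∧
          ω ∈ openConnIn {x : Site 3 | 0 ≤ x 0 ∧ ∃ i : Fin 3, ((m ^ j * r₀ : ℕ) : ℤ) < |x i|} w y} ≤
      C₀ * (m : ℝ) ^ (-b * k)) →
    Summit.CriticalPhenomena.PercolationContinuityZ3.Theses.PercBoundarySqueeze.HalfSpaceOneArmRate := by
  rintro ⟨m, r₀, b, C₀, hm, hr₀, hb, hQ⟩
  exact ⟨b, max C₀ 1 * ((m : ℝ) * r₀) ^ b, hb, armH_rate_of_shellProductWith hm hr₀ (by linarith) hQ⟩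

/-! ## Tightness: the stub's exponent window is `1/2 < b ≤ 2` -/

/-- **The shell-decay stub with exponent `b > 2` is FALSE.** A per-scale bound
`P_{p_c}(ShellCross_H(r, m r)) ≤ m^{-b}` for all `r ≥ r₀` with `b > 2` would give
`P_{p_c}(arm_H(0,r)) ≤ C r^{-b}` (`armH_rate_of_shellDecayWith`), contradicting the disprover's floor
`P_{p_c}(arm_H(0,n+1)) ≥ 1/(588 (n+1)²)` (`not_quantitativeBGNWith_of_two_lt`, from `φ_{p_c}(Λ_n) ≥ 1`).
So the open stub `stub_shellDecay` lives in the window `1/2 < b ≤ 2` (numerically `b` up to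
`x_s ≈ 0.975`). [folklore] -/
theorem not_shellDecayWith_of_two_lt {m r₀ : ℕ} {b : ℝ} (hm : 2 ≤ m) (hr₀ : 1 ≤ r₀) (hb : 2 < b) :
    ¬ ∀ r : ℕ, r₀ ≤ r →
      (bondPercolation (zdGraph 3) (criticalProbI 3)).real
        {ω | ∃ w y : Site 3, (∀ i : Fin 3, |w i| ≤ (r : ℤ) + 1) ∧ (∃ i : Fin 3, ((m * r : ℕ) : ℤ) ≤ |y i|) ∧
          ω ∈ openConnIn {x : Site 3 | 0 ≤ x 0 ∧ ∃ i : Fin 3, (r : ℤ) < |x i|} w y} ≤ (m : ℝ) ^ (-b) := by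
  intro hQ
  exact not_quantitativeBGNWith_of_two_lt hb
    ⟨((m : ℝ) * r₀) ^ b, armH_rate_of_shellDecayWith hm hr₀ (by linarith) hQ⟩

/-- Existential packaging of `not_shellDecayWith_of_two_lt`: no `(m, r₀, b)` with `b > 2` satisfies the
per-scale shell-decay bound. [folklore] -/
theorem not_exists_shellDecay_two_lt :
    ¬ ∃ (m r₀ : ℕ) (b : ℝ), 2 ≤ m ∧ 1 ≤ r₀ ∧ 2 < b ∧ ∀ r : ℕ, r₀ ≤ r →
      (bondPercolation (zdGraph 3) (criticalProbI 3)).real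
        {ω | ∃ w y : Site 3, (∀ i : Fin 3, |w i| ≤ (r : ℤ) + 1) ∧ (∃ i : Fin 3, ((m * r : ℕ) : ℤ) ≤ |y i|) ∧
          ω ∈ openConnIn {x : Site 3 | 0 ≤ x 0 ∧ ∃ i : Fin 3, (r : ℤ) < |x i|} w y} ≤ (m : ℝ) ^ (-b) := by
  rintro ⟨m, r₀, b, hm, hr₀, hb, hQ⟩
  exact not_shellDecayWith_of_two_lt hm hr₀ hb hQ

end HalfSpaceOneArmRateOfShellDecay

end Summit.CriticalPhenomena.PercolationContinuityZ3.Theorems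

end
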